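import Summits.CriticalPhenomena.SAWScalingLimit.Theses.SAWParafermion
import HarnessLib

/-!
# `stub_dockOfCrux`: the crux `SubseqIdentification` implies the dock S1 (identification up to κ)

Necessity anchor of the reduction of the line `boundary-area-law` for the crux `SubseqIdentification`
(stmt-CriticalPhenomena-0783; primary decl `SAWParafermion.SubseqIdentification`, identical shared decl
`SAWRenewalTightness.SubseqIdentification`). The line reduces the crux (every subsequential weak limit of
the critical `δℤ²` SAW laws of a Dobrushin domain, along a mesh sequence `s → 0⁺`, is chordal
SLE_{8/3}) to

* the DOCK S1 "identification up to κ": for every mesh sequence `s → 0⁺` ONE `κ > 0` such that every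
  weak limit along `s`, in every Dobrushin domain with every endpoint approximation, is an SLE_κ law;
* the lattice boundary area law S4;

(`SubseqIdentification_of_dock_of_latticeAreaLaw`, given `EventualTight`). This file records the trivial
converse direction crux ⇒ S1, which makes the dock a NECESSARY condition: given the crux, the constant
choice `κ := 8/3` (independent of `s`) works, since the crux is exactly the statement that every such
weak limit is `IsSLELaw (8/3) D μ`. No named fact is used beyond the definition of the crux.
-/

open MeasureTheory Filter Topology Set
open scoped NNReal ENNReal BoundedContinuousFunction

namespace Summit.CriticalPhenomena.SAWScalingLimit.Theorems.SubseqIdentification.BoundaryAreaLaw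

open Literature.Probability.RandomPlanarGeometry Literature.Probability.LatticeModels
open Summit.CriticalPhenomena.SAWScalingLimit.Theses.SAWParafermion (SubseqIdentification)

/-- **Crux ⇒ dock S1 (necessity anchor N4 of the line `boundary-area-law`).** If every subsequential
weak limit of the critical `δℤ²` SAW laws is chordal SLE_{8/3} (`SubseqIdentification`), then for every
mesh sequence `s → 0⁺` there is one `κ > 0` — namely `κ = 8/3` — such that every weak limit along `s`,
in every Dobrushin domain `D` with endpoint approximation `(a, b)`, is an SLE_κ law of `D`. Pure logic:
instantiate the crux at `(D, a, b, s, μ)` and reorder the hypotheses. [folklore] -/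
theorem stub_dockOfCrux :
    SubseqIdentification →
      ∀ (s : ℕ → ℝ), Tendsto s atTop (𝓝[>] (0 : ℝ)) →
        ∃ κ : ℝ≥0, 0 < κ ∧
          ∀ (D : DobrushinDomain) (a b : ℝ → Site 2), SAW.IsEndpointApprox D a b →
            ∀ (μ : Measure (CurveClass ℂ)), IsProbabilityMeasure μ →
              (∀ f : CurveClass ℂ →ᵇ ℝ,
                Tendsto (fun n => ∫ γ, f γ.curve ∂(SAW.law D.carrier (s n) (a (s n)) (b (s n))))
                  atTop (𝓝 (∫ x, f x ∂μ))) →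
              IsSLELaw κ D μ :=
  fun h s hs => ⟨8 / 3, by positivity, fun D a b hab μ hμ hlim => h D a b hab s μ hs hμ hlim⟩

end Summit.CriticalPhenomena.SAWScalingLimit.Theorems.SubseqIdentification.BoundaryAreaLaw
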